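import Literature.MathematicalPhysics.QuantumLattice.LayeredVariationalPressure
import Literature.MathematicalPhysics.QuantumLattice.HubbardTTPrimeDiagHopTransportThermal
import Literature.MathematicalPhysics.QuantumLattice.HubbardTTPrimeAnchorWordBoxTransport
import Literature.MathematicalPhysics.QuantumLattice.HubbardHoppingFamilyLatticeSymmetry
import HarnessLib

/-!
# The CANONICAL (fixed-density) variational pressure `P(β, Ψ; ρ) = sup {s̄(ω) − βe_Ψ(ω) : ω translation invariant, ρ(ω) = ρ}`,
# its identification with the `t–t'` Hubbard canonical pressure `pressureTT'`, and T > 0 DIMENSION RAISING AT FIXED DENSITY: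
# `p(β; t,t',U; ρ) ≤ P_3(β, layered t–t' crystal; ρ) ≤ p(β; t,t',U; ρ) + β(4/π)Σ_b|tz_b|` — canonical 2D certificates are 3D words

Topic `Literature/MathematicalPhysics/QuantumLattice` (family `hubbard`; crew hubbard-fast S2, D-0096 (iii) «interlayer coupling» at `T > 0`,
written for the CANONICAL certificates of the hubbard-thermal crew: `pressureTT' β t t' U n`, the thermodynamic-limit canonical pressure of
`HubbardTTPrimeThermalPressureLimit`). `TIVariationalPressure` / `LayeredVariationalPressure` are grand canonical (unconstrained supremum).
Here the supremum is constrained to a density `ρ`: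

* §1 `FermionInteraction.varPressureAt β Ψ R ρ` (`P(β,Ψ;ρ)`): trial principle (`sub_mul_le_varPressureAt`), least-bound reading
  (`varPressureAt_le`), `P(β,Ψ;ρ) ≤ P(β,Ψ)`; `ε`-approximate constrained equilibria obey the master inequality, the coupling update along
  linear families and the **Griffiths window with slack** at fixed density (`…_of_approxAt`) — the trial states keep their density.
* §2 **IDENTIFICATION**: `P(β, Φ(t,t',U); ρ) = pressureTT' β t t' U ρ` for `β > 0`, `U ≥ 0`, `0 < ρ < 2` (`varPressureAt_hubbardTTPrime_eq`:
  `≤` from `entropyDensitySup_sub_mul_le_pressureTT'` for every translation-invariant state of density `ρ`, `≥` from a canonical thermal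
  torus-limit state, which exists (`exists_isTorusLimitOfMixture_sectorGibbs`), is translation invariant of density `ρ` and attains `p`).
* §3 **DIMENSION RAISING AT FIXED DENSITY** (abstract, as in `LayeredVariationalPressure` §2, using that stacks and layer marginals PRESERVE
  THE DENSITY): floor from stacks, cap from marginals, and «constrained near-equilibria have near-equilibrium marginals».
* §4 **LAYERED CRYSTALS**: `P_{d+1}(β, layered; ρ) ∈ [P_d(β, one band; ρ), P_d + |β|(4/π)Σ|tz|]` (`varPressureAt_layeredModel_mem_Icc`) and
  for the `t–t'` crystal **`P_3(β, layeredHubbardTTPrime; ρ) ∈ [pressureTT' β t t' U ρ, pressureTT' β t t' U ρ + β(4/π)Σ_b|tz_b|]`**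
  (`varPressureAt_layeredHubbardTTPrime_mem_Icc_pressureTT'`), equality at `tz = 0`; and **THERMAL DOUBLE OCCUPANCY OF 3D STATES FROM THREE
  2D CANONICAL PRESSURES**: a translation-invariant 3D state of density `ρ` within `ε'` of `P_3(·;ρ)` has
  `D ∈ [(p(U) − p(U+δ) − ε)/(βδ), (p(U−δ) − p(U) + ε)/(βδ)]`, `p(·) = pressureTT' β t t' · ρ`, `ε = ε' + β(4/π)Σ|tz|`
  (`docc_mem_Icc_of_approxAt_layeredHubbardTTPrime`).

Everything is PROVED; the one definition (`varPressureAt`) has a body; no named fact, no number. HONEST SCOPE: variational objects; the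
existence of exact constrained 3D equilibria is not claimed (the `ε'`-approximate form always applies: the supremum is approached).

## Mathlib / tree search

REUSED: `varPressure`, `bddAbove_varFunctional_image`, `entropyDensitySup`, `IsTranslationInvariant.entropyDensitySup_sub_mul_le_pressureTT'`,
`IsTorusLimitOfMixture.entropyDensitySup_sub_mul_eq_pressureTT'_of_sectorGibbs` (`TIVariationalPressure`); `exists_isTorusLimitOfMixture_sectorGibbs`
(`HubbardTTPrimeDiagHopTransportThermal`), `IsTorusLimitOfMixture.isTranslationInvariant`, `…density_eq_of_sectorGibbs`; `entropyDensitySup_stack`,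
`IsTranslationInvariant.entropyDensitySup_le_layerMarginal`, `meanEnergy_stack_layeredModel_of_isTranslationInvariant`,
`IsTranslationInvariant.abs_meanEnergy_layeredModel_sub_mapAct_le` (`LayeredVariationalPressure`); `density_stack`, `density_mapAct`,
`stack_isTranslationInvariant`, `layeredHubbardTTPrime`, `hubbardTTPrimeFermionInteraction_eq_vectorHoppingModel` (`LayeredLatticeEnergyTransport`);
`hubbardTTPrimeFermionInteraction_eq_linearFamily_vec`, `hubbardTTPrimeDirections` (`HubbardTTPrimeAnchorWordBoxTransport`, `…CouplingFamilies`);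
`IsTranslationInvariant.meanEnergy_onSite_mapAct` (`HubbardHoppingFamilyLatticeSymmetry`); `exists_isTranslationInvariant_density_eq`.
`lean search 'varPressureAt|constrained variational pressure|pressureTT'.*layered'` (2026-08-28): nothing.

## References

* H. Araki, H. Moriya, Rev. Math. Phys. 15 (2003) 93–198, §11–§12 (variational principle). [cite: ArakiMoriya2003, Theorem 12.11]
* R. B. Israel, *Convexity in the Theory of Lattice Gases* (1979), Thm. I.2.4, Thm. I.3.4, Lemma II.3.1. [cite: Israel1979, Thm. I.3.4]
* O. Bratteli, A. Kishimoto, D. W. Robinson, Commun. Math. Phys. 64 (1978) 41, Thm. 2. [cite: BratteliKishimotoRobinson1978, Thm. 2 (condition 2)]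
* R. B. Griffiths, J. Math. Phys. 5 (1964) 1215, eq. (39). [cite: Griffiths1964, Eq. (39) and Fig. 3]
-/

noncomputable section

open scoped ComplexOrder BigOperators
open Finset Literature.InformationTheory.Entropy

namespace Literature.MathematicalPhysics.QuantumLattice

open Matrix HubbardWave0 Literature.Probability.LatticeModels ThermodynamicLimit
open _root_.Filter
open scoped _root_.Topology

/-! ### §1 The constrained variational pressure -/

namespace FermionInteraction

variable {d : ℕ}

/-- **The canonical (fixed-density) variational pressure** `P(β,Ψ;ρ) = sup {s̄(ω) − βe_Ψ(ω) : ω translation invariant, ρ(ω) = ρ}`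
(`sSup ∅ = 0` if no translation-invariant state has density `ρ`). [cite: Israel1979, Lemma II.3.1] [cite: ArakiMoriya2003, Theorem 12.11] -/
def varPressureAt (β : ℝ) (Ψ : FermionInteraction d) (R ρ : ℝ) : ℝ :=
  sSup ((fun ω : InfVolFermionState d => ω.entropyDensitySup - β * ω.meanEnergy Ψ R) ''
    {ω : InfVolFermionState d | ω.IsTranslationInvariant ∧ ω.density = ρ})

variable (β : ℝ) (Ψ : FermionInteraction d) (R ρ : ℝ)

/-- The constrained image is bounded above (it is part of the unconstrained one). [cite: BratteliRobinsonI1987, Prop. 2.3.11] -/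
theorem bddAbove_varFunctionalAt_image :
    BddAbove ((fun ω : InfVolFermionState d => ω.entropyDensitySup - β * ω.meanEnergy Ψ R) ''
      {ω : InfVolFermionState d | ω.IsTranslationInvariant ∧ ω.density = ρ}) :=
  (Ψ.bddAbove_varFunctional_image β R).mono (Set.image_mono fun _ h => h.1)

/-- **Trial principle at fixed density**: `s̄(ω) − βe_Ψ(ω) ≤ P(β,Ψ;ρ)` for every translation-invariant `ω` of density `ρ`.
[cite: Israel1979, Lemma II.3.1] -/
theorem sub_mul_le_varPressureAt {ω : InfVolFermionState d} (hω : ω.IsTranslationInvariant) (hρ : ω.density = ρ) :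
    ω.entropyDensitySup - β * ω.meanEnergy Ψ R ≤ Ψ.varPressureAt β R ρ :=
  le_csSup (Ψ.bddAbove_varFunctionalAt_image β R ρ) (Set.mem_image_of_mem _ ⟨hω, hρ⟩)

/-- **Least-bound reading**: if some translation-invariant state has density `ρ`, a number above `s̄ − βe_Ψ` of every such state caps
`P(β,Ψ;ρ)`. [cite: Israel1979, Lemma II.3.1] -/
theorem varPressureAt_le {c : ℝ} (hne : ∃ ω : InfVolFermionState d, ω.IsTranslationInvariant ∧ ω.density = ρ)
    (h : ∀ ω : InfVolFermionState d, ω.IsTranslationInvariant → ω.density = ρ → ω.entropyDensitySup - β * ω.meanEnergy Ψ R ≤ c) :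
    Ψ.varPressureAt β R ρ ≤ c := by
  obtain ⟨ω₀, hω₀, hρ₀⟩ := hne
  exact csSup_le ⟨_, Set.mem_image_of_mem _ ⟨hω₀, hρ₀⟩⟩ (by
    rintro _ ⟨ω, ⟨hω, hρ⟩, rfl⟩
    exact h ω hω hρ)

/-- `P(β,Ψ;ρ) ≤ P(β,Ψ)` (when the density is realised). [cite: Israel1979, Lemma II.3.1] -/
theorem varPressureAt_le_varPressure (hne : ∃ ω : InfVolFermionState d, ω.IsTranslationInvariant ∧ ω.density = ρ) :
    Ψ.varPressureAt β R ρ ≤ Ψ.varPressure β R :=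
  Ψ.varPressureAt_le β R ρ hne fun _ hω _ => Ψ.sub_mul_le_varPressure β R hω

end FermionInteraction

namespace InfVolFermionState

variable {d : ℕ} {β : ℝ} {Φ : FermionInteraction d} {R ρ ε : ℝ} {ν : InfVolFermionState d}

/-- **Master inequality with slack at fixed density**: a translation-invariant `ν` of density `ρ` with `s̄(ν) − βe_Φ(ν) ≥ P(β,Φ;ρ) − ε` gives
`P(β₁,Φ₁;ρ) ≥ P(β,Φ;ρ) + βe_Φ(ν) − β₁e_{Φ₁}(ν) − ε`. [cite: Israel1979, Thm. I.2.4] -/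
theorem varPressureAt_add_le_of_approxAt (hν : ν.IsTranslationInvariant) (hρ : ν.density = ρ)
    (h : Φ.varPressureAt β R ρ - ε ≤ ν.entropyDensitySup - β * ν.meanEnergy Φ R)
    (β₁ : ℝ) (Φ₁ : FermionInteraction d) (R₁ : ℝ) :
    Φ.varPressureAt β R ρ + β * ν.meanEnergy Φ R - β₁ * ν.meanEnergy Φ₁ R₁ - ε ≤ Φ₁.varPressureAt β₁ R₁ ρ := by
  have h1 := Φ₁.sub_mul_le_varPressureAt β₁ R₁ ρ hν hρ
  linarith

variable {ι : Type*} [Fintype ι] {Ψ₀ : FermionInteraction d} {Ψv : ι → FermionInteraction d}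

/-- **Coupling update with slack at fixed density**: `P(θ + δ1_a; ρ) ≥ P(θ; ρ) − βδ e_a(ν) − ε`. [cite: Israel1979, Thm. I.2.4] -/
theorem varPressureAt_sub_mul_le_update_of_approxAt [DecidableEq ι] {θ : ι → ℝ} (hν : ν.IsTranslationInvariant) (hρ : ν.density = ρ)
    (h : (FermionInteraction.linearFamily Ψ₀ Ψv θ).varPressureAt β R ρ - ε ≤
      ν.entropyDensitySup - β * ν.meanEnergy (FermionInteraction.linearFamily Ψ₀ Ψv θ) R) (a : ι) (δ : ℝ) :
    (FermionInteraction.linearFamily Ψ₀ Ψv θ).varPressureAt β R ρ - β * δ * ν.meanEnergy (Ψv a) R - ε ≤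
      (FermionInteraction.linearFamily Ψ₀ Ψv (θ + Pi.single a δ)).varPressureAt β R ρ := by
  set θ' : ι → ℝ := θ + Pi.single a δ with hθ'
  have hm := varPressureAt_add_le_of_approxAt hν hρ h β (FermionInteraction.linearFamily Ψ₀ Ψv θ') R
  rw [ν.meanEnergy_linearFamily_eq_add_sum_sub_mul Ψ₀ Ψv θ' θ R] at hm
  have hs : ∑ x, (θ' x - θ x) * ν.meanEnergy (Ψv x) R = δ * ν.meanEnergy (Ψv a) R := by
    simp only [hθ', Pi.add_apply, add_sub_cancel_left]
    rw [Finset.sum_eq_single a]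
    · rw [Pi.single_eq_same]
    · intro b _ hb; rw [Pi.single_eq_of_ne hb, zero_mul]
    · intro ha; exact absurd (Finset.mem_univ a) ha
  rw [hs] at hm
  linarith

/-- **Griffiths window with slack at fixed density** (`β, δ > 0`):
`(P(θ;ρ) − P(θ+δ1_a;ρ) − ε)/(βδ) ≤ e_a(ν) ≤ (P(θ−δ1_a;ρ) − P(θ;ρ) + ε)/(βδ)`. [cite: Griffiths1964, Eq. (39) and Fig. 3] [cite: Israel1979, Thm. I.2.4] -/
theorem meanEnergy_mem_Icc_of_approxAt [DecidableEq ι] {θ : ι → ℝ} (hν : ν.IsTranslationInvariant) (hρ : ν.density = ρ) (hβ : 0 < β)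
    (h : (FermionInteraction.linearFamily Ψ₀ Ψv θ).varPressureAt β R ρ - ε ≤
      ν.entropyDensitySup - β * ν.meanEnergy (FermionInteraction.linearFamily Ψ₀ Ψv θ) R) (a : ι) {δ : ℝ} (hδ : 0 < δ) :
    ν.meanEnergy (Ψv a) R ∈ Set.Icc
      (((FermionInteraction.linearFamily Ψ₀ Ψv θ).varPressureAt β R ρ -
          (FermionInteraction.linearFamily Ψ₀ Ψv (θ + Pi.single a δ)).varPressureAt β R ρ - ε) / (β * δ))
      (((FermionInteraction.linearFamily Ψ₀ Ψv (θ + Pi.single a (-δ))).varPressureAt β R ρ -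
          (FermionInteraction.linearFamily Ψ₀ Ψv θ).varPressureAt β R ρ + ε) / (β * δ)) := by
  have hβδ : 0 < β * δ := mul_pos hβ hδ
  have hup := varPressureAt_sub_mul_le_update_of_approxAt hν hρ h a δ
  have hdn := varPressureAt_sub_mul_le_update_of_approxAt hν hρ h a (-δ)
  constructor
  · rw [div_le_iff₀ hβδ]; linarith
  · rw [le_div_iff₀ hβδ]; linarith

end InfVolFermionState

/-! ### §2 Identification with the canonical `t–t'` Hubbard pressure -/

section Hubbard

/-- **THE CANONICAL VARIATIONAL PRESSURE OF THE `t–t'` HUBBARD MODEL IS `pressureTT'`**: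
`P(β, Φ(t,t',U); ρ) = pressureTT' β t t' U ρ` for `β > 0`, `U ≥ 0`, `0 < ρ < 2`. [cite: ArakiMoriya2003, Theorem 12.11] [cite: Israel1979, Lemma II.3.1] -/
theorem varPressureAt_hubbardTTPrime_eq {β : ℝ} (hβ : 0 < β) (t t' : ℝ) {U : ℝ} (hU : 0 ≤ U) {ρ : ℝ} (hρ0 : 0 < ρ) (hρ2 : ρ < 2) :
    (hubbardTTPrimeFermionInteraction t t' U).varPressureAt β 1 ρ = pressureTT' β t t' U ρ := by
  refine le_antisymm ?_ ?_
  · refine (hubbardTTPrimeFermionInteraction t t' U).varPressureAt_le β 1 ρ (exists_isTranslationInvariant_density_eq hρ0 hρ2)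
      fun ω hω hωρ => ?_
    have h := hω.entropyDensitySup_sub_mul_le_pressureTT' t t' hU hβ (by rw [hωρ]; exact hρ0) (by rw [hωρ]; exact hρ2)
    rw [hωρ] at h
    exact h
  · obtain ⟨φ, hφ, ω, hω⟩ := exists_isTorusLimitOfMixture_sectorGibbs β t t' U hρ0.le hρ2.le (Ls := fun n => n) tendsto_id
    have hLs : Tendsto ((fun n : ℕ => n) ∘ φ) atTop atTop := hφ.tendsto_atTop
    have hTI := hω.isTranslationInvariant
    have hρ := hω.density_eq_of_sectorGibbs t t' U hρ0.le hρ2.le β hLs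
    have heq := hω.entropyDensitySup_sub_mul_eq_pressureTT'_of_sectorGibbs t t' hU hβ hρ0 hρ2 hLs
    rw [← heq]
    exact (hubbardTTPrimeFermionInteraction t t' U).sub_mul_le_varPressureAt β 1 ρ hTI hρ

end Hubbard

/-! ### §3 Dimension raising at fixed density (abstract) -/

section Abstract

variable {d : ℕ} (β : ℝ) {Φ : FermionInteraction d} {Ψ : FermionInteraction (d + 1)} {R R' C : ℝ} (ρ : ℝ)

/-- **FLOOR from stacks at fixed density**: stacks preserve the density, so `P_d(β,Φ;ρ) ≤ P_{d+1}(β,Ψ;ρ)` when stack energies agree.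
[cite: ArakiMoriya2003, §11.1 Theorem 11.2] [cite: Israel1979, Thm. I.3.4] -/
theorem varPressureAt_le_of_stack (hd : 0 < d)
    (hstack : ∀ (ω₀ : InfVolFermionState d) (hω₀ : ω₀.IsTranslationInvariant),
      (ω₀.stack (hω₀.isEven hd)).meanEnergy Ψ R' = ω₀.meanEnergy Φ R)
    (hne : ∃ ω₀ : InfVolFermionState d, ω₀.IsTranslationInvariant ∧ ω₀.density = ρ) :
    Φ.varPressureAt β R ρ ≤ Ψ.varPressureAt β R' ρ := by
  refine Φ.varPressureAt_le β R ρ hne fun ω₀ hω₀ hρ₀ => ?_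
  have h := Ψ.sub_mul_le_varPressureAt β R' ρ (InfVolFermionState.stack_isTranslationInvariant hω₀ (hω₀.isEven hd))
    (by rw [InfVolFermionState.density_stack, hρ₀])
  rw [hstack ω₀ hω₀, InfVolFermionState.entropyDensitySup_stack] at h
  exact h

/-- **CAP from layer marginals at fixed density**: marginals preserve the density, so `P_{d+1}(β,Ψ;ρ) ≤ P_d(β,Φ;ρ) + |β|C` when
`|e_Ψ(ω) − e_Φ(ω∘Γ_layer)| ≤ C` for all translation-invariant `ω`. [cite: Israel1979, Thm. I.3.4] [cite: BratteliKishimotoRobinson1978, Thm. 2 (condition 2)] -/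
theorem varPressureAt_le_of_layerMarginal (hd : 0 < d)
    (hmarg : ∀ ω : InfVolFermionState (d + 1), ω.IsTranslationInvariant →
      |ω.meanEnergy Ψ R' - (ω.mapAct (layerHom d) (layerHom_injective d)).meanEnergy Φ R| ≤ C)
    (hne : ∃ ω₀ : InfVolFermionState d, ω₀.IsTranslationInvariant ∧ ω₀.density = ρ) :
    Ψ.varPressureAt β R' ρ ≤ Φ.varPressureAt β R ρ + |β| * C := by
  have hne' : ∃ ω : InfVolFermionState (d + 1), ω.IsTranslationInvariant ∧ ω.density = ρ := by
    obtain ⟨ω₀, hω₀, hρ₀⟩ := hne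
    exact ⟨_, InfVolFermionState.stack_isTranslationInvariant hω₀ (hω₀.isEven hd),
      by rw [InfVolFermionState.density_stack, hρ₀]⟩
  refine Ψ.varPressureAt_le β R' ρ hne' fun ω hω hωρ => ?_
  have hm : (ω.mapAct (layerHom d) (layerHom_injective d)).IsTranslationInvariant :=
    hω.mapAct (layerHom d) (layerHom_injective d)
  have hmρ : (ω.mapAct (layerHom d) (layerHom_injective d)).density = ρ := by
    rw [InfVolFermionState.density_mapAct _ _ _ (map_zero _), hωρ]
  have h1 := Φ.sub_mul_le_varPressureAt β R ρ hm hmρ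
  have h2 := hω.entropyDensitySup_le_layerMarginal
  have h3 : β * (ω.mapAct (layerHom d) (layerHom_injective d)).meanEnergy Φ R - β * ω.meanEnergy Ψ R' ≤ |β| * C := by
    rw [← mul_sub]
    refine (le_abs_self _).trans ?_
    rw [abs_mul, abs_sub_comm]
    exact mul_le_mul_of_nonneg_left (hmarg ω hω) (abs_nonneg β)
  linarith

/-- **Two-sided dimension raising at fixed density.** [cite: BratteliKishimotoRobinson1978, Thm. 2 (condition 2)] [cite: Israel1979, Thm. I.3.4] -/
theorem varPressureAt_mem_Icc_of_stack_of_layerMarginal (hd : 0 < d)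
    (hstack : ∀ (ω₀ : InfVolFermionState d) (hω₀ : ω₀.IsTranslationInvariant),
      (ω₀.stack (hω₀.isEven hd)).meanEnergy Ψ R' = ω₀.meanEnergy Φ R)
    (hmarg : ∀ ω : InfVolFermionState (d + 1), ω.IsTranslationInvariant →
      |ω.meanEnergy Ψ R' - (ω.mapAct (layerHom d) (layerHom_injective d)).meanEnergy Φ R| ≤ C)
    (hne : ∃ ω₀ : InfVolFermionState d, ω₀.IsTranslationInvariant ∧ ω₀.density = ρ) :
    Ψ.varPressureAt β R' ρ ∈ Set.Icc (Φ.varPressureAt β R ρ) (Φ.varPressureAt β R ρ + |β| * C) :=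
  ⟨varPressureAt_le_of_stack β ρ hd hstack hne, varPressureAt_le_of_layerMarginal β ρ hd hmarg hne⟩

/-- **Constrained near-equilibria have near-equilibrium marginals**: a translation-invariant `ω` on `ℤ^{d+1}` (of density `ρ`) with
`s̄(ω) − βe_Ψ(ω) ≥ P_{d+1}(β,Ψ;ρ) − ε'` has a layer marginal (translation invariant, density `ρ`) with
`s̄ − βe_Φ ≥ P_d(β,Φ;ρ) − ε' − |β|C`. [cite: BratteliKishimotoRobinson1978, Thm. 2 (condition 2)] [cite: ArakiMoriya2003, Theorem 12.11] -/
theorem InfVolFermionState.IsTranslationInvariant.varPressureAt_sub_le_layerMarginal_of_approxAt (hd : 0 < d)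
    {ω : InfVolFermionState (d + 1)} (hω : ω.IsTranslationInvariant) {ε' : ℝ}
    (happ : Ψ.varPressureAt β R' ρ - ε' ≤ ω.entropyDensitySup - β * ω.meanEnergy Ψ R')
    (hstack : ∀ (ω₀ : InfVolFermionState d) (hω₀ : ω₀.IsTranslationInvariant),
      (ω₀.stack (hω₀.isEven hd)).meanEnergy Ψ R' = ω₀.meanEnergy Φ R)
    (hmarg : ∀ ω : InfVolFermionState (d + 1), ω.IsTranslationInvariant →
      |ω.meanEnergy Ψ R' - (ω.mapAct (layerHom d) (layerHom_injective d)).meanEnergy Φ R| ≤ C)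
    (hne : ∃ ω₀ : InfVolFermionState d, ω₀.IsTranslationInvariant ∧ ω₀.density = ρ) :
    Φ.varPressureAt β R ρ - (ε' + |β| * C) ≤
      (ω.mapAct (layerHom d) (layerHom_injective d)).entropyDensitySup -
        β * (ω.mapAct (layerHom d) (layerHom_injective d)).meanEnergy Φ R := by
  have hP := varPressureAt_le_of_stack β ρ hd hstack hne (Ψ := Ψ) (R' := R')
  have h2 := hω.entropyDensitySup_le_layerMarginal
  have h3 : β * (ω.mapAct (layerHom d) (layerHom_injective d)).meanEnergy Φ R - β * ω.meanEnergy Ψ R' ≤ |β| * C := by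
    rw [← mul_sub]
    refine (le_abs_self _).trans ?_
    rw [abs_mul, abs_sub_comm]
    exact mul_le_mul_of_nonneg_left (hmarg ω hω) (abs_nonneg β)
  linarith

end Abstract

/-! ### §4 Layered crystals at fixed density; the `t–t'` crystal keyed to `pressureTT'` -/

section Layered

variable {d : ℕ} {ι κ : Type*} [Fintype ι] [Fintype κ]

/-- **Dimension raising at fixed density for layered one-band crystals**:
`P_{d+1}(β, layered; ρ) ∈ [P_d(β, one band; ρ), P_d(β, one band; ρ) + |β|(4/π)Σ_b|tz_b|]` (density `ρ` realised on `ℤ^d`).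
[cite: BratteliKishimotoRobinson1978, Thm. 2 (condition 2)] [cite: Israel1979, Thm. I.3.4] -/
theorem varPressureAt_layeredModel_mem_Icc (hd : 0 < d) (β U : ℝ) {u : ι → Site d} (hu : ∀ a, u a ≠ 0) (θ : ι → ℝ)
    {w : κ → Site (d + 1)} (hw : ∀ b, w b 0 ≠ 0) (tz : κ → ℝ) {R R' : ℝ} (hR : 1 ≤ R) (hRR' : R ≤ R')
    (huR : ∀ a, u a ∈ thicken ({0} : Finset (Site d)) R) (hwR' : ∀ b, w b ∈ thicken ({0} : Finset (Site (d + 1))) R')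
    {ρ : ℝ} (hne : ∃ ω₀ : InfVolFermionState d, ω₀.IsTranslationInvariant ∧ ω₀.density = ρ) :
    (layeredModel U u θ w tz).varPressureAt β R' ρ ∈
      Set.Icc ((vectorHoppingModel U u θ).varPressureAt β R ρ)
        ((vectorHoppingModel U u θ).varPressureAt β R ρ + |β| * (4 / Real.pi * ∑ b, |tz b|)) :=
  varPressureAt_mem_Icc_of_stack_of_layerMarginal β ρ hd
    (meanEnergy_stack_layeredModel_of_isTranslationInvariant hd U hu θ hw tz hR hRR' huR hwR')
    (fun ω hω => hω.abs_meanEnergy_layeredModel_sub_mapAct_le U hu θ (fun b h0 => hw b (by rw [h0]; rfl)) tz hR hRR'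
      huR hwR') hne

/-- **T > 0 DIMENSION RAISING KEYED TO THE 2D CANONICAL PRESSURE** (`β > 0`, `U ≥ 0`, `0 < ρ < 2`; interlayer vectors `w_b` with
`(w_b)₀ ≠ 0` in the range box `R' ≥ 1`):
**`P_3(β, layeredHubbardTTPrime t t' U w tz; ρ) ∈ [pressureTT' β t t' U ρ, pressureTT' β t t' U ρ + β(4/π)Σ_b|tz_b|]`** — every certified
canonical 2D pressure window is a window for the layered crystal's canonical variational pressure.
[cite: BratteliKishimotoRobinson1978, Thm. 2 (condition 2)] [cite: Israel1979, Thm. I.3.4] -/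
theorem varPressureAt_layeredHubbardTTPrime_mem_Icc_pressureTT' {β : ℝ} (hβ : 0 < β) (t t' : ℝ) {U : ℝ} (hU : 0 ≤ U)
    {w : κ → Site 3} (hw : ∀ b, w b 0 ≠ 0) (tz : κ → ℝ) {R' : ℝ} (hR' : 1 ≤ R')
    (hwR' : ∀ b, w b ∈ thicken ({0} : Finset (Site 3)) R') {ρ : ℝ} (hρ0 : 0 < ρ) (hρ2 : ρ < 2) :
    (layeredHubbardTTPrime t t' U w tz).varPressureAt β R' ρ ∈
      Set.Icc (pressureTT' β t t' U ρ) (pressureTT' β t t' U ρ + β * (4 / Real.pi * ∑ b, |tz b|)) := by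
  have h := varPressureAt_layeredModel_mem_Icc two_pos β U ttPrimeVec_ne_zero (ttPrimeAmp t t') hw tz le_rfl hR'
    ttPrimeVec_mem_thicken_one hwR' (exists_isTranslationInvariant_density_eq hρ0 hρ2)
  rw [← hubbardTTPrimeFermionInteraction_eq_vectorHoppingModel, varPressureAt_hubbardTTPrime_eq hβ t t' hU hρ0 hρ2,
    abs_of_pos hβ] at h
  exact h

/-- **Decoupled layers at fixed density**: `P_3(β, layeredHubbardTTPrime(tz = 0); ρ) = pressureTT' β t t' U ρ`.
[cite: ArakiMoriya2003, §11.1 Theorem 11.2] -/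
theorem varPressureAt_layeredHubbardTTPrime_zero {β : ℝ} (hβ : 0 < β) (t t' : ℝ) {U : ℝ} (hU : 0 ≤ U)
    {w : κ → Site 3} (hw : ∀ b, w b 0 ≠ 0) {R' : ℝ} (hR' : 1 ≤ R') (hwR' : ∀ b, w b ∈ thicken ({0} : Finset (Site 3)) R')
    {ρ : ℝ} (hρ0 : 0 < ρ) (hρ2 : ρ < 2) :
    (layeredHubbardTTPrime t t' U w fun _ => 0).varPressureAt β R' ρ = pressureTT' β t t' U ρ := by
  have h := varPressureAt_layeredHubbardTTPrime_mem_Icc_pressureTT' hβ t t' hU hw (fun _ => 0) hR' hwR' hρ0 hρ2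
  simp only [abs_zero, Finset.sum_const_zero, mul_zero, add_zero] at h
  exact le_antisymm h.2 h.1

/-- **Near-equilibrium 3D states of density `ρ` have near-equilibrium layer marginals** (canonical reading, `β > 0`, `U ≥ 0`,
`0 < ρ < 2`): `pressureTT' β t t' U ρ − (ε' + β(4/π)Σ|tz|) ≤ s̄(ω∘Γ_layer) − β e_Φ(ω∘Γ_layer)`.
[cite: BratteliKishimotoRobinson1978, Thm. 2 (condition 2)] [cite: ArakiMoriya2003, Theorem 12.11] -/
theorem InfVolFermionState.IsTranslationInvariant.pressureTT'_sub_le_layerMarginal_of_approxAt {β : ℝ} (hβ : 0 < β) (t t' : ℝ)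
    {U : ℝ} (hU : 0 ≤ U) {w : κ → Site 3} (hw : ∀ b, w b 0 ≠ 0) (tz : κ → ℝ) {R' : ℝ} (hR' : 1 ≤ R')
    (hwR' : ∀ b, w b ∈ thicken ({0} : Finset (Site 3)) R') {ρ : ℝ} (hρ0 : 0 < ρ) (hρ2 : ρ < 2)
    {ω : InfVolFermionState 3} (hω : ω.IsTranslationInvariant) {ε' : ℝ}
    (happ : (layeredHubbardTTPrime t t' U w tz).varPressureAt β R' ρ - ε' ≤
      ω.entropyDensitySup - β * ω.meanEnergy (layeredHubbardTTPrime t t' U w tz) R') :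
    pressureTT' β t t' U ρ - (ε' + β * (4 / Real.pi * ∑ b, |tz b|)) ≤
      (ω.mapAct (layerHom 2) (layerHom_injective 2)).entropyDensitySup -
        β * (ω.mapAct (layerHom 2) (layerHom_injective 2)).meanEnergy (hubbardTTPrimeFermionInteraction t t' U) 1 := by
  have h := hω.varPressureAt_sub_le_layerMarginal_of_approxAt β ρ two_pos happ
    (Φ := vectorHoppingModel U ttPrimeVec (ttPrimeAmp t t')) (R := 1)
    (meanEnergy_stack_layeredModel_of_isTranslationInvariant two_pos U ttPrimeVec_ne_zero (ttPrimeAmp t t') hw tz le_rfl hR'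
      ttPrimeVec_mem_thicken_one hwR')
    (fun ω hω => hω.abs_meanEnergy_layeredModel_sub_mapAct_le U ttPrimeVec_ne_zero (ttPrimeAmp t t')
      (fun b h0 => hw b (by rw [h0]; rfl)) tz le_rfl hR' ttPrimeVec_mem_thicken_one hwR')
    (exists_isTranslationInvariant_density_eq hρ0 hρ2)
  rw [← hubbardTTPrimeFermionInteraction_eq_vectorHoppingModel, varPressureAt_hubbardTTPrime_eq hβ t t' hU hρ0 hρ2,
    abs_of_pos hβ] at h
  exact h

/-- Moving `U` is a coordinate update of the `t–t'–U` linear family. [cite: XuEtAl2024, eq. (1)] -/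
theorem hubbardTTPrime_update_U (t t' U δ : ℝ) :
    FermionInteraction.linearFamily (hubbardTTPrimeFermionInteraction 0 0 0) hubbardTTPrimeDirections (![t, t', U] + Pi.single 2 δ) =
      hubbardTTPrimeFermionInteraction t t' (U + δ) := by
  rw [hubbardTTPrimeFermionInteraction_eq_linearFamily_vec t t' (U + δ)]
  congr 1
  ext i
  fin_cases i <;> simp

/-- The `U`-direction of the `t–t'–U` family is the pure on-site repulsion: its conjugate density on a 2D state is the double occupancy
`e_{Φ^{0,1}}`. [cite: XuEtAl2024, eq. (1)] -/
theorem hubbardTTPrimeDirections_two : hubbardTTPrimeDirections 2 = hubbardFermionInteraction 2 0 1 := by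
  show hubbardTTPrimeFermionInteraction 0 0 1 = hubbardFermionInteraction 2 0 1
  rw [hubbardTTPrimeFermionInteraction_eq_vectorHoppingModel, vectorHoppingModel]
  refine FermionInteraction.ext fun X => ?_
  rw [FermionInteraction.linearFamily_apply]
  simp [ttPrimeAmp, Fin.sum_univ_four]

/-- **THERMAL DOUBLE OCCUPANCY OF 3D STATES FROM THREE 2D CANONICAL PRESSURES.** Let `β > 0`, `U ≥ 0` with `U − δ ≥ 0`, `δ > 0`,
`0 < ρ < 2`, and let `ω` be a translation-invariant state of the layered `t–t'` crystal of density `ρ` within `ε'` of `P_3(·;ρ)`. Then its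
double occupancy `D = e_{Φ^{0,1}}(ω)` satisfies, with `p(·) = pressureTT' β t t' · ρ` and `ε = ε' + β(4/π)Σ_b|tz_b|`:
`(p(U) − p(U+δ) − ε)/(βδ) ≤ D ≤ (p(U−δ) − p(U) + ε)/(βδ)`. [cite: Griffiths1964, Eq. (39) and Fig. 3] [cite: BratteliKishimotoRobinson1978, Thm. 2 (condition 2)] -/
theorem InfVolFermionState.IsTranslationInvariant.docc_mem_Icc_of_approxAt_layeredHubbardTTPrime {β : ℝ} (hβ : 0 < β) (t t' : ℝ)
    {U δ : ℝ} (hδ : 0 < δ) (hUδ : 0 ≤ U - δ) {w : κ → Site 3} (hw : ∀ b, w b 0 ≠ 0) (tz : κ → ℝ) {R' : ℝ} (hR' : 1 ≤ R')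
    (hwR' : ∀ b, w b ∈ thicken ({0} : Finset (Site 3)) R') {ρ : ℝ} (hρ0 : 0 < ρ) (hρ2 : ρ < 2)
    {ω : InfVolFermionState 3} (hω : ω.IsTranslationInvariant) (hωρ : ω.density = ρ) {ε' : ℝ}
    (happ : (layeredHubbardTTPrime t t' U w tz).varPressureAt β R' ρ - ε' ≤
      ω.entropyDensitySup - β * ω.meanEnergy (layeredHubbardTTPrime t t' U w tz) R') :
    ω.meanEnergy (hubbardFermionInteraction 3 0 1) R' ∈ Set.Icc
      ((pressureTT' β t t' U ρ - pressureTT' β t t' (U + δ) ρ - (ε' + β * (4 / Real.pi * ∑ b, |tz b|))) / (β * δ))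
      ((pressureTT' β t t' (U - δ) ρ - pressureTT' β t t' U ρ + (ε' + β * (4 / Real.pi * ∑ b, |tz b|))) / (β * δ)) := by
  have hU : 0 ≤ U := by linarith
  have happm := hω.pressureTT'_sub_le_layerMarginal_of_approxAt hβ t t' hU hw tz hR' hwR' hρ0 hρ2 happ
  rw [← varPressureAt_hubbardTTPrime_eq hβ t t' hU hρ0 hρ2, hubbardTTPrimeFermionInteraction_eq_linearFamily_vec] at happm
  have hm : (ω.mapAct (layerHom 2) (layerHom_injective 2)).IsTranslationInvariant := hω.mapAct (layerHom 2) (layerHom_injective 2)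
  have hmρ : (ω.mapAct (layerHom 2) (layerHom_injective 2)).density = ρ := by
    rw [InfVolFermionState.density_mapAct _ _ _ (map_zero _), hωρ]
  have h := InfVolFermionState.meanEnergy_mem_Icc_of_approxAt hm hmρ hβ happm 2 hδ
  rw [hubbardTTPrime_update_U, hubbardTTPrime_update_U, ← sub_eq_add_neg, ← hubbardTTPrimeFermionInteraction_eq_linearFamily_vec,
    varPressureAt_hubbardTTPrime_eq hβ t t' hU hρ0 hρ2, varPressureAt_hubbardTTPrime_eq hβ t t' (by linarith) hρ0 hρ2,
    varPressureAt_hubbardTTPrime_eq hβ t t' hUδ hρ0 hρ2, hubbardTTPrimeDirections_two,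
    hω.meanEnergy_onSite_mapAct (layerHom 2) (layerHom_injective 2) 1 le_rfl hR'] at h
  exact h

end Layered

end Literature.MathematicalPhysics.QuantumLattice

end
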